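import Summits.Ventures.PercRepro.GenQSolidFacts

/-!
# PercRepro — the rank-`r` flat rows of the profile LP, for every `r` (night-4, gen 7)

The two solid rows of the `(8, 6)` cell (`GenQSolidFacts`: (S1s≤) `card_Pc_sub_four_le` and (S5s) `B4_le`, the
rank-`4` flats) and night-2's line rows (`betaL` / `Nl` / `Bl`, the rank-`2` flats) are the instances `r = 4` and
`r = 2` of ONE counting statement, stated here for every rank `r ≤ q` — the structural piece of the diagonal that
does not grow with `q`: for a rank-`r` flat `F` of `M` let `betaR M G F q r` be the number of `(q − r)`-subsets
`K ⊆ G ∖ F` with `rk(K ∪ (F ∩ G)) = q` (the bases of the contraction by `F` inside `G`), `NR M G r s` the number of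
rank-`r` flats with `s` points of `G` and `BR M G q r s = Σ_{|F ∩ G| = s} betaR`.

* (S1r≤) `card_Pc_sub_le`: the level-`k` sets of cyclic rank `r` (`m(S) = q − r`: cyclic part `Z` of rank `r`, inside
  the flat `cl Z`, with `d − k + r` points) number at most `Σ_s C(s, d − k + r)·BR s` — the map `S ↦ (Z, K)` into the
  pairs (a `(d − k + r)`-subset of `F ∩ G`, a base of the contraction) is injective (`S = Z ∪ K`);
* (S5r) `BR_le`: `BR s ≤ C(|G| − s, q − r)·NR s`;
* `betaR_four`, `NR_four`, `BR_four`: the `r = 4` instances are the solid rows of record, definitionally.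

The `(9, 7)` cell needs exactly the instance `r = 5` (the rank-`5` flats, `≤ 21` points on the core; sheet §61 (g));
nothing in the proofs depends on `r`.  Imports `GenQSolidFacts` (for the `r = 4` identifications; the proofs use
only `GenQProfileFacts` and night-2's `lineOf` facts).
-/
namespace PercRepro.Night4

open Finset ThmH SixFour GenQ PerFlat Star

variable {α : Type*} [DecidableEq α] {M : Matroid α} [M.Finite]

/-! ## The rank-`r` flats and their contractions -/

/-- The bases of the contraction by the flat `F` inside `G` at rank `r`:
`#{K ⊆ G ∖ F : |K| = q − r, rk(K ∪ (F ∩ G)) = q}`. -/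
noncomputable def betaR (M : Matroid α) [M.Finite] (G F : Finset α) (q r : ℕ) : ℕ :=
  (((G \ F).powersetCard (q - r)).filter
    (fun K : Finset α => M.eRk ((K ∪ (F ∩ G) : Finset α) : Set α) = (q : ℕ∞))).card

/-- `betaR ≤ C(|G ∖ F|, q − r)`. -/
theorem betaR_le (G F : Finset α) (q r : ℕ) : betaR M G F q r ≤ (G \ F).card.choose (q - r) := by
  unfold betaR
  exact (Finset.card_filter_le _ _).trans (le_of_eq (Finset.card_powersetCard _ _))

/-- `NR r s = #{F ∈ flatsQ M r : |F ∩ G| = s}`: the rank-`r` flats with `s` points of `G`. -/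
noncomputable def NR (M : Matroid α) [M.Finite] (G : Finset α) (r s : ℕ) : ℕ :=
  ((flatsQ M r).filter (fun F : Finset α => (F ∩ G).card = s)).card

/-- `BR r s = Σ_{F ∈ flatsQ M r, |F ∩ G| = s} betaR`. -/
noncomputable def BR (M : Matroid α) [M.Finite] (G : Finset α) (q r s : ℕ) : ℕ :=
  ∑ F ∈ (flatsQ M r).filter (fun F : Finset α => (F ∩ G).card = s), betaR M G F q r

/-- The `r = 4` instance is the solid count `betaF` of record. -/
theorem betaR_four (G F : Finset α) (q : ℕ) : betaR M G F q 4 = betaF M G F q := rfl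

/-- The `r = 4` instance is the solid count `N4` of record. -/
theorem NR_four (G : Finset α) (s : ℕ) : NR M G 4 s = N4 M G s := rfl

/-- The `r = 4` instance is the solid row `B4` of record. -/
theorem BR_four (G : Finset α) (q s : ℕ) : BR M G q 4 s = B4 M G q s := rfl

/-- A sum over the rank-`r` flats of `f(|F ∩ G|)·betaR` is `Σ_s f(s)·BR s` (`s ≤ |G|`). -/
theorem sum_flats_mul_betaR_eq (G : Finset α) (q r : ℕ) (f : ℕ → ℕ) :
    ∑ F ∈ flatsQ M r, f (F ∩ G).card * betaR M G F q r =
      ∑ s ∈ Finset.range (G.card + 1), f s * BR M G q r s := by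
  rw [← Finset.sum_fiberwise_of_maps_to (s := flatsQ M r) (t := Finset.range (G.card + 1))
    (g := fun F : Finset α => (F ∩ G).card) (fun F _ => Finset.mem_coe.2 (Finset.mem_range.2
      (Nat.lt_succ_of_le (Finset.card_le_card Finset.inter_subset_right))))]
  apply Finset.sum_congr rfl
  intro s _
  unfold BR
  rw [Finset.mul_sum]
  apply Finset.sum_congr rfl
  intro F hF
  rw [(Finset.mem_filter.1 hF).2]

/-- **(S5r)** `BR s ≤ C(|G| − s, q − r)·NR s`. -/
theorem BR_le (G : Finset α) (q r s : ℕ) : BR M G q r s ≤ (G.card - s).choose (q - r) * NR M G r s := by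
  unfold BR NR
  rw [Finset.card_eq_sum_ones ((flatsQ M r).filter (fun F : Finset α => (F ∩ G).card = s)), Finset.mul_sum]
  apply Finset.sum_le_sum
  intro F hF
  have hl := (Finset.mem_filter.1 hF).2
  have h := betaR_le (M := M) G F q r
  have hsd : (G \ F).card = G.card - (F ∩ G).card := by
    have h2 := Finset.card_sdiff_add_card_inter G F
    rw [Finset.inter_comm] at h2
    omega
  rw [hsd, hl] at h
  rw [mul_one]
  exact h

/-! ## The flat of a set of cyclic rank `r` -/

/-- For `S ∈ Pc k (q − r)` (`r ≤ q`): the cyclic part has rank `r`, so its closure `lineOf S` is a rank-`r` flat. -/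
theorem lineOf_mem_flatsQ_of_Pc {G S : Finset α} {q k r : ℕ} (hG : G ⊆ gr M) (hr : r ≤ q)
    (hS : S ∈ Pc M G q k (q - r)) : lineOf M S ∈ flatsQ M r := by
  have hS' := mem_Pc.1 hS
  have hrk := eRk_sdiff_coloopsOf_add_mTr hG hS'.1
  rw [hS'.2.2] at hrk
  have hrr : M.eRk ((S \ coloopsOf M S : Finset α) : Set α) = (r : ℕ∞) := by
    obtain ⟨a, ha⟩ := exists_eRk_eq_nat (M := M) (S \ coloopsOf M S)
    rw [ha] at hrk ⊢
    have h' : a + (q - r) = q := by exact_mod_cast hrk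
    have : a = r := by omega
    rw [this]
  rw [mem_flatsQ]
  refine ⟨?_, ?_, ?_⟩
  · intro x hx
    unfold lineOf clF at hx
    rw [Set.Finite.mem_toFinset] at hx
    rw [← Finset.mem_coe, coe_gr M]
    exact M.closure_subset_ground _ hx
  · unfold lineOf
    rw [coe_clF]
    exact Matroid.isFlat_closure _
  · unfold lineOf
    rw [coe_clF, Matroid.eRk_closure_eq, hrr]

/-- **(S1r≤)** The level-`k` sets of cyclic rank `r` whose flat is `F` inject into the pairs `(Z, K)`:
`#{S ∈ Pc k (q−r) : lineOf S = F} ≤ C(|F ∩ G|, d − k + r)·betaR M G F q r`. -/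
theorem card_filter_lineOf_le_of_rank {G : Finset α} {q d k r : ℕ} (hG : G ⊆ gr M)
    (hrG : M.eRk (G : Set α) = (q : ℕ∞)) (hr : r ≤ q) (hcard : G.card = q + d) (hk : k < d)
    {F : Finset α} :
    ((Pc M G q k (q - r)).filter (fun S : Finset α => lineOf M S = F)).card ≤
      (F ∩ G).card.choose (d - k + r) * betaR M G F q r := by
  unfold betaR
  rw [← Finset.card_powersetCard, ← Finset.card_product]
  apply Finset.card_le_card_of_injOn (fun S => (S \ coloopsOf M S, coloopsOf M S))
  · intro S hS
    rw [Finset.mem_coe, Finset.mem_filter] at hS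
    obtain ⟨hSc, hline⟩ := hS
    have hS' := mem_Pc.1 hSc
    have hSG := (mem_Rq.1 hS'.1).1
    have hsd := Finset.card_sdiff_of_subset hSG
    have hle := Finset.card_le_card hSG
    rw [hS'.2.1] at hsd
    rw [Finset.mem_coe, Finset.mem_product, Finset.mem_powersetCard, Finset.mem_filter, Finset.mem_powersetCard]
    refine ⟨⟨hline ▸ sdiff_coloopsOf_subset_lineOf_inter hG hSc, ?_⟩, ⟨hline ▸ coloopsOf_subset_sdiff_lineOf hSc, hS'.2.2⟩, ?_⟩
    · rw [card_sdiff_coloopsOf, hS'.2.2]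
      omega
    · apply le_antisymm
      · rw [← hrG]
        apply M.eRk_mono
        rw [Finset.coe_union]
        refine Set.union_subset ?_ ?_
        · exact (Finset.coe_subset.2 (coloopsOf_subset S)).trans (Finset.coe_subset.2 hSG)
        · exact Finset.coe_subset.2 Finset.inter_subset_right
      · rw [← (mem_Rq.1 hS'.1).2]
        apply M.eRk_mono
        rw [Finset.coe_union]
        intro y hy
        have hy' := Finset.mem_coe.1 hy
        by_cases hyK : y ∈ coloopsOf M S
        · exact Or.inl (Finset.mem_coe.2 hyK)
        · exact Or.inr (Finset.mem_coe.2 (hline ▸ sdiff_coloopsOf_subset_lineOf_inter hG hSc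
            (Finset.mem_sdiff.2 ⟨hy', hyK⟩)))
  · intro S₁ hS₁ S₂ hS₂ heq
    simp only [Prod.mk.injEq] at heq
    have h1 : S₁ = (S₁ \ coloopsOf M S₁) ∪ coloopsOf M S₁ := (Finset.sdiff_union_of_subset (coloopsOf_subset S₁)).symm
    have h2 : S₂ = (S₂ \ coloopsOf M S₂) ∪ coloopsOf M S₂ := (Finset.sdiff_union_of_subset (coloopsOf_subset S₂)).symm
    rw [h1, h2, heq.1, heq.2]

/-- **(S1r≤), summed over the rank-`r` flats**: `#Pc k (q − r) ≤ Σ_s C(s, d − k + r)·BR r s`, for every `r ≤ q`. -/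
theorem card_Pc_sub_le {G : Finset α} {q d k r : ℕ} (hG : G ⊆ gr M)
    (hrG : M.eRk (G : Set α) = (q : ℕ∞)) (hr : r ≤ q) (hcard : G.card = q + d) (hk : k < d) :
    (Pc M G q k (q - r)).card ≤
      ∑ s ∈ Finset.range (G.card + 1), s.choose (d - k + r) * BR M G q r s := by
  rw [← sum_flats_mul_betaR_eq]
  rw [Finset.card_eq_sum_card_fiberwise (s := Pc M G q k (q - r)) (t := flatsQ M r)
    (f := fun S => lineOf M S) (fun S hS => Finset.mem_coe.2 (lineOf_mem_flatsQ_of_Pc hG hr hS))]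
  apply Finset.sum_le_sum
  intro F _
  exact card_filter_lineOf_le_of_rank hG hrG hr hcard hk

/-- The solid row (S1s≤) of record is the instance `r = 4`. -/
theorem card_Pc_sub_four_le' {G : Finset α} {q d k : ℕ} (hG : G ⊆ gr M)
    (hrG : M.eRk (G : Set α) = (q : ℕ∞)) (hq : 4 ≤ q) (hcard : G.card = q + d) (hk : k < d) :
    (Pc M G q k (q - 4)).card ≤
      ∑ s ∈ Finset.range (G.card + 1), s.choose (d - k + 4) * B4 M G q s :=
  card_Pc_sub_le hG hrG hq hcard hk

end PercRepro.Night4
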